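import Summits.ValiantsHypothesis.ValiantsHypothesis.Theorems.KPlusLogSqLawTropicalBTwoRowSharp

/-!
# Route «KPlusLogSqLaw», crux `TropicalB` (stmt-ValiantsHypothesis-19771) — the RANK-PROFILE law: a common refinement of the thin law
# and of slope counting

HONEST FRAMING.  Helper file (seat val-sym-trop-p4 (g2), cell `pub-symmetroid`, 2026-08-26).  A COUNTING bound valid at every format, inside
the crux's known regime; nothing on `TropicalB` in its window, `WeakLifting`, `MatrixDescartes` (stmt-ValiantsHypothesis-18050) or VP ≠ VNP.

Two census laws of the tree bound a sign-alternating dominant chain of format `(m, K)` by an injection: the THIN LAW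
(`TropicalCensus.tropRootLawAt_thin`: `k ↦ (σ_k, termRank)` is injective, `≤ m!·(m(K−1)+1)` terms) and SLOPE COUNTING
(`TropicalCensus.tropRootLawAt_slopeCount`: `k ↦ classSym` is injective, `≤ C(m+K−1, m)` terms).  Their common refinement: the RANK
PROFILE `k ↦ (multiset of exponent ranks of the classes of p_k)` is already injective — equal rank profiles give equal exponent VALUES
(`d_eq_of_dRank_eq`), hence equal slopes — and for a fixed total rank `r` the chain has at most `m!` terms (distinct permutations) AND at
most `π_{m,K}(r)` terms, `π_{m,K}(r) = #{S ∈ Sym (Fin K) m : ∑ S = r}` (distinct profiles).  Hence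

* `tropRootLawAt_rankProfile` — `TropRootLawAt m K ((∑_{r=0}^{m(K−1)} min(m!, π_{m,K}(r))) − 1)`.

It implies both laws (`min ≤` either argument) and is strictly better in the crossover; at `m = 2` it is the sharp `4K − 7`
(`…TwoRowSharp`, `…TwoRowFamily`: `π_{2,K}(r) = 1` exactly at the four extreme ranks), and at `m = 3` it evaluates to `18K − 53` for large `K`
(against the thin law's `18K − 13`; not evaluated in the kernel here).  [folklore counting]
-/

set_option linter.dupNamespace false
set_option autoImplicit false

namespace Summit.ValiantsHypothesis.ValiantsHypothesis.Theorems.KPlusLogSqLaw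

open Summit.ValiantsHypothesis.ValiantsHypothesis.Theorems.MatrixDescartes.Negative
open Summit.ValiantsHypothesis.ValiantsHypothesis.Theorems.LacunarySymmetroidMatrixDescartes
open Summit.ValiantsHypothesis.ValiantsHypothesis.Theorems.LacunarySymmetroidMatrixDescartes.TropicalCensus
open Finset

/-- **Rank-profile law.**  Every sign-alternating dominant chain of format `(m, K)` has at most
`∑_{r=0}^{m(K−1)} min(m!, π_{m,K}(r))` terms, where `π_{m,K}(r)` is the number of multisets of `m` classes whose indices sum to `r`
(an upper bound for the number of rank profiles of total rank `r`). [folklore counting] -/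
theorem tropRootLawAt_rankProfile (m K : ℕ) :
    TropRootLawAt m K ((∑ r ∈ range (m * (K - 1) + 1),
      min m.factorial ((univ.filter fun S : Sym (Fin K) m => ((S : Multiset (Fin K)).map Fin.val).sum = r).card)) - 1) := by
  classical
  intro d v ε n θ p hε hθ hdom halt
  rcases Nat.eq_zero_or_pos K with hK0 | hKpos
  · subst hK0; exact tropRootLawAt_zero m _ d v ε n θ p hε hθ hdom halt
  have hinj : Function.Injective p := stub_dominantInjective m K d v ε n θ p hθ hdom halt
  -- (1) same permutation ⇒ total rank strictly increases (as in `tropRootLawAt_thin`)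
  have hkey : ∀ a b : Fin (n + 1), a < b → (p a).1 = (p b).1 → termRank d (p a) < termRank d (p b) := by
    intro a b hab h1
    have hne : p a ≠ p b := fun h => (ne_of_lt hab) (hinj h)
    have h2 : (p a).2 ≠ (p b).2 := fun h => hne (Prod.ext h1 h)
    obtain ⟨i, hi⟩ := Function.ne_iff.mp h2
    have hpa : p a = ((p a).1, (p a).2) := rfl
    have hpb : p b = ((p a).1, (p b).2) := by rw [h1]
    have hda : IsDominant d v ε (θ a) ((p a).1, (p a).2) := hpa ▸ hdom a
    have hdb : IsDominant d v ε (θ b) ((p a).1, (p b).2) := hpb ▸ hdom b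
    have hmono : ∀ j, dRank d ((p a).2 j) ≤ dRank d ((p b).2 j) := by
      intro j
      by_cases hj : (p a).2 j = (p b).2 j
      · rw [hj]
      · exact (dRank_lt_of_lt d (d_lt_of_dominant d v ε (hθ hab) _ _ _ hda hdb j hj)).le
    have hstrict : dRank d ((p a).2 i) < dRank d ((p b).2 i) :=
      dRank_lt_of_lt d (d_lt_of_dominant d v ε (hθ hab) _ _ _ hda hdb i hi)
    unfold termRank
    exact sum_lt_sum (fun j _ => hmono j) ⟨i, mem_univ _, hstrict⟩
  have hsame : ∀ a b : Fin (n + 1), (p a).1 = (p b).1 → termRank d (p a) = termRank d (p b) → a = b := by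
    intro a b h1 h2
    rcases lt_trichotomy a b with h | h | h
    · exact absurd h2 (ne_of_lt (hkey a b h h1))
    · exact h
    · exact absurd h2.symm (ne_of_lt (hkey b a h h1.symm))
  -- (2) equal slopes ⇒ equal indices
  have hslope : ∀ a b : Fin (n + 1), TropicalCensus.slope d (p a) = TropicalCensus.slope d (p b) → a = b := by
    intro a b hs
    rcases lt_trichotomy a b with h | h | h
    · exact absurd hs (ne_of_lt (slope_lt_of_dominant d v ε (hθ h) (fun e => (ne_of_lt h) (hinj e)) (hdom a) (hdom b)))
    · exact h
    · exact absurd hs.symm (ne_of_lt (slope_lt_of_dominant d v ε (hθ h) (fun e => (ne_of_lt h) (hinj e)) (hdom b) (hdom a)))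
  -- (3) the rank profile: ranks as elements of `Fin K`, and exponent values as a function of ranks
  let rankFin : Fin K → Fin K := fun l => ⟨dRank d l, lt_of_le_of_lt (dRank_le d l) (by omega)⟩
  let g : ℕ → ℕ := fun r => if h : ∃ l : Fin K, dRank d l = r then d h.choose else 0
  have hg : ∀ l, g (dRank d l) = d l := by
    intro l
    have hex : ∃ l' : Fin K, dRank d l' = dRank d l := ⟨l, rfl⟩
    simp only [g, dif_pos hex]
    exact d_eq_of_dRank_eq d hex.choose_spec
  let S : Fin (n + 1) → Sym (Fin K) m := fun k => (classSym (p k)).map rankFin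
  have hS_sum : ∀ k, (((S k : Sym (Fin K) m) : Multiset (Fin K)).map Fin.val).sum = termRank d (p k) := by
    intro k
    simp only [S, Sym.coe_map, classSym, Sym.coe_mk, Multiset.map_map]
    rfl
  have hS_slope : ∀ k, TropicalCensus.slope d (p k) = (((S k : Sym (Fin K) m) : Multiset (Fin K)).map fun l => (g l.val : ℤ)).sum := by
    intro k
    rw [slope_eq_of_classSym]
    simp only [S, Sym.coe_map, Multiset.map_map]
    congr 1
    refine Multiset.map_congr rfl fun l _ => ?_
    simp only [Function.comp, rankFin, hg]
  have hS_inj : ∀ a b, S a = S b → a = b := by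
    intro a b h
    apply hslope
    rw [hS_slope, hS_slope, h]
  -- (4) counting by total rank
  set N := m * (K - 1) + 1 with hN
  set π : ℕ → ℕ := fun r => (univ.filter fun T : Sym (Fin K) m => ((T : Multiset (Fin K)).map Fin.val).sum = r).card with hπ
  have hmaps : Set.MapsTo (fun k => termRank d (p k)) (↑(univ : Finset (Fin (n + 1)))) (↑(range N)) := by
    intro k _
    rw [coe_range, Set.mem_Iio, hN]
    exact Nat.lt_succ_of_le (termRank_le d (p k))
  have hcount : (univ : Finset (Fin (n + 1))).card =
      ∑ r ∈ range N, (univ.filter fun k : Fin (n + 1) => termRank d (p k) = r).card :=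
    card_eq_sum_card_fiberwise hmaps
  have hfib : ∀ r, (univ.filter fun k : Fin (n + 1) => termRank d (p k) = r).card ≤ min m.factorial (π r) := by
    intro r
    refine le_min ?_ ?_
    · -- distinct permutations
      have h := card_le_card_of_injOn (s := univ.filter fun k : Fin (n + 1) => termRank d (p k) = r)
        (t := (univ : Finset (Equiv.Perm (Fin m)))) (fun k => (p k).1) (fun _ _ => mem_coe.mpr (mem_univ _)) ?_
      · rwa [card_univ, Fintype.card_perm, Fintype.card_fin] at h
      · intro a ha b hb hab
        rw [mem_coe, mem_filter] at ha hb
        exact hsame a b hab (ha.2.trans hb.2.symm)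
    · -- distinct rank profiles of total rank `r`
      refine card_le_card_of_injOn S ?_ ?_
      · intro k hk
        rw [mem_coe, mem_filter] at hk ⊢
        exact ⟨mem_univ _, by rw [hS_sum, hk.2]⟩
      · intro a _ b _ hab
        exact hS_inj a b hab
  have htot : n + 1 ≤ ∑ r ∈ range N, min m.factorial (π r) := by
    calc n + 1 = (univ : Finset (Fin (n + 1))).card := by rw [card_univ, Fintype.card_fin]
      _ = ∑ r ∈ range N, (univ.filter fun k : Fin (n + 1) => termRank d (p k) = r).card := hcount
      _ ≤ ∑ r ∈ range N, min m.factorial (π r) := sum_le_sum fun r _ => hfib r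
  show n ≤ (∑ r ∈ range N, min m.factorial (π r)) - 1
  omega

end Summit.ValiantsHypothesis.ValiantsHypothesis.Theorems.KPlusLogSqLaw
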